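import Mathlib
import Summits.Langlands.Langlands.Theses.NonParallelVoid
import Literature.NumberTheory.PAdicHodge.FontaineDpst
import Literature.NumberTheory.PAdicHodge.CrystallineBaseChange
import Literature.NumberTheory.PAdicHodge.FontainePstLabelledWeightsSchemata
import Literature.NumberTheory.PAdicHodge.LabelledHodgeTateWeightsBaseChangeLabelwise
import Literature.NumberTheory.GaloisRepresentations.ToLocalRestrictField
import Literature.NumberTheory.GaloisRepresentations.RestrictFieldSelf
import Literature.NumberTheory.GaloisRepresentations.AbsGaloisOuterConj
import Literature.NumberTheory.GaloisRepresentations.PstCrystallineExtensionData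
import Literature.NumberTheory.GaloisRepresentations.PotentialDiagonalizability
import Literature.NumberTheory.GaloisRepresentations.PadicAlgebraDegreeOnePlace
import Literature.NumberTheory.Automorphic.GaloisActionPlaces
import Summits.Langlands.Langlands.Theorems.NonParallelVoidTensorSquareParallelStubTensorInductionExists
import Summits.Langlands.Langlands.Theorems.NonParallelVoidEmptyWeightCoreStubSplitPrime
import Summits.Langlands.Langlands.Theorems.NonParallelVoidTensorSquareParallelStubLabelExtension
import Summits.Langlands.Langlands.Theorems.NonParallelVoidTensorSquareParallelStubOrdinaryDihedralVoid
import Summits.Langlands.Langlands.Theorems.NonParallelVoidTensorSquareParallelStubTensorLocalPlumbing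
import HarnessLib
import Literature.NumberTheory.PAdicHodge.FontainePstKroneckerSchemata

/-!
# Stub `stub_tensorInductionLocal` of line `merged` (v3), crux `TensorSquareParallel`
# (stmt-Langlands-17009), RE-TYPED: the local clause (T3) of Calegari's tensor induction,
# (a) crystalline ∧ (b) four distinct labelled weights ∧ (c) crystalline extension data —
# conditional on two NAMED Kronecker schemata for THE pinned Fontaine datum

The registered stub asks, for `F/ℚ` imaginary quadratic, `p` split, `ρ : Γ_F → GL₂(ℚ̄_p)`
pinned-crystalline above `p` with labelled Hodge–Tate weights `{a<b}` at `(v₀,τ)`, `{a'<b'}` at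
`(w₀,σ)`, `b−a ≠ b'−a'`, and EVERY `ψ : Γ_ℚ → GL₄(ℚ̄_p)` whose restriction to `Γ_F` is a frame
change of the relabelled Kronecker product `ρ ⊗ ρ^{θ_{τ₀}}` (conjunct (T0') of the landed
`stub_tensorInductionExists`, p169281), that at the place `v` of `ℚ` above `p` and for THE pinned
datum `fontainePstAdicCompletion v p hv`: (a) `ψ|_{Γ_{ℚ_v}}` is crystalline, (b) every labelled
Hodge–Tate multiset of `ψ` at `v` has four distinct elements, (c) compatible crystalline extension
data exist, (d) `ψ|_{Γ_{ℚ_v}}` is potentially diagonalisable for every such datum.  Wave-1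
diagnosis (not re-litigated): the pinned datum is Hilbert-ε over the SPECIFICATION
`IsFontaineDatum` (clauses (F1)–(F14), file `PAdicHodge/FontaineDpst`), none of which relates
crystallinity / labelled weights of a tensor product, or of a transport along an isomorphism of
local fields, to those of the factors; and (d) contains the printed OPEN QUESTION of [BLGGT] §1.4
(potential diagonalisability of two-dimensional crystalline representations of `Γ_{ℚ_p}` with
large gap; ledger item stmt-Langlands-14643 `PD2Unram`; Calegari 2012, FM II, p. 3: "out of
reach").

## The re-typing (this file = (2a); (2b) is reported, not landed)

* **(2a) `stub_tensorLocalCrystalline_of_schemata`** (PROVED here):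
  `FontaineDatumExists → Literature.NumberTheory.PAdicHodge.KroneckerCrystallineSchema → Literature.NumberTheory.PAdicHodge.KroneckerLabelledWeightsSchema →`
  `CrystallineBaseChange → LabelledHodgeTateWeightsBaseChangeLabelwise →` (registered hypotheses)
  `→` (T0') `→ ∀ v hv,` (a) `∧` (b) `∧` (c) — the registered statement with its conclusion cut to
  (a) ∧ (b) ∧ (c), under five NAMED FACTS: Fontaine's existence theorem (T0 fact of the pin, for
  (c) = clause (F10)), the two Kronecker schemata BELOW (new; `D_cris`, `D_dR` are ⊗-functors),
  and the two accepted base-change facts `CrystallineBaseChange` (Fontaine Exp. VIII §2.3.7 /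
  Brinon–Conrad §9.1) and `LabelledHodgeTateWeightsBaseChangeLabelwise` (Brinon–Conrad
  Prop. 6.3.8, p167048), each used TWICE: along the continuous isomorphism `F_{w₀} ≅ F_{v₀}`
  induced by the non-trivial `ḡ = τ̄₀ ∈ Gal(F/ℚ)` (the pinned data at `w₀` and at `v₀ = ḡ⁻¹ • w₀`
  are ε-chosen INDEPENDENTLY, so even this transport is a statement about Fontaine's
  construction, i.e. (S3) of the brief = the accepted base-change facts in degree one), and along
  the inverse `F_{v₀} → ℚ_v` of the degree-one isomorphism `ℚ_v ≅ F_{v₀}`.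
* **(2b) `stub_tensorLocalPD`** (NOT proved — open input, = [BLGGT] §1.4 question for the
  rank-two factors + §1.4 remark (5) `ρ₁∼ρ₂, ρ₁'∼ρ₂' ⇒ ρ₁⊗ρ₁' ∼ ρ₂⊗ρ₂'`): (registered hypotheses)
  `→ ∀ ψ,` (T0') `→ ∀ v hv, letI := (fontainePstAdicCompletion v p hv).algebra;`
  `∀ 𝔈 : PstCrystallineExtensionData (fontainePstAdicCompletion v p hv),`
  `IsPotentiallyDiagonalizable 𝔈.𝔅 (ψ.toLocal v)` — elaborates (checked in scratch); (2a) ∧ (2b)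
  recombine to EXACTLY the registered conjunction (a) ∧ (b) ∧ (c) ∧ (d).

## Proof of (2a) (all plumbing in `…StubTensorLocalPlumbing`, accepted vocabulary only)

Let `R := P⁻¹ ψ|_{Γ_F} P`, so `R(σ) = e_*(ρ(σ) ⊗ₖ ρ(θ σ))` by (T0').  (0) `v₀ ≠ w₀` (equal places
have ONE label at a split prime, `subsingleton_algHom_adicCompletion_of_degree_one`, hence equal
gaps); so `e = f = 1` at both (`ramificationIdx_eq_one_and_inertiaDeg_eq_one_of_ne`) and both lie
over `v` (`heightOneSpectrum_rat_eq_of_natCast_mem`).  (1) `τ₀ ∉ res(Γ_F)` means `ḡ = τ̄₀ ≠ 1`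
(`absGaloisQuot_eq_one_iff`); `Gal(F/ℚ)` has order `2` and acts transitively on `{v₀, w₀}`
(`exists_algEquiv_smul_eq`), so `ḡ⁻¹ • w₀ = v₀`.  (2) Localising at `v₀ ∣ v`
(`exists_toLocal_restrictField_eq_conj`): `ψ|_{Γ_{ℚ_v}} ∘ res_{ℚ_v → F_{v₀}}` is a frame change of
`R|_{Γ_{F_{v₀}}}`, whose Kronecker factors are `ρ|_{Γ_{F_{v₀}}}` and `(ρ ∘ θ)|_{Γ_{F_{v₀}}}`; the
latter is a frame change of `ρ|_{Γ_{F_{w₀}}} ∘ res_{F_{w₀} → F_{v₀}}`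
(`exists_toLocal_comp_absGaloisOuterConj_eq_conj`: the outer action moves decomposition groups).
(3) Crystallinity: factors by `hG` and `CrystallineBaseChange` along `ḡ⁻¹ : F_{w₀} ≅ F_{v₀}`;
product by `KroneckerCrystallineSchema`; then `CrystallineBaseChange` along the continuous inverse
`F_{v₀} → ℚ_v` (`continuous_symm_adicCompletionOfLiesOver_of_degree_one`) and the frame change
`exists_comp_absGaloisRestrict_comp_absGaloisRestrict_eq_conj` give (a) (frame invariance
`isCrystallineFramed_conj_iff`).  (4) Weights at a label `τ` of `ℚ_v`: label by label along
`F_{v₀} → ℚ_v` the weights are those of `R|_{Γ_{F_{v₀}}}` at `τ₁ = τ ∘ (F_{v₀} → ℚ_v)` (a pinned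
label, `exists_algHom_toRingHom_eq_comp`), which by `KroneckerLabelledWeightsSchema` are the
pairwise sums of `HT_{τ₁}(ρ|_{F_{v₀}}) = {a, b}` (one label at `v₀`) and
`HT_{τ₁}((ρ∘θ)|_{F_{v₀}}) = HT_{τ₁ ∘ ḡ⁻¹}(ρ|_{F_{w₀}}) = {a', b'}` (labelwise base change, one
label at `w₀`): the multiset `{a+a', a+b', b+a', b+b'}`, of cardinality `4` and without repetition
iff `b−a ≠ b'−a'` (`nodup_and_card_pairSum`) — (b).  (5) (c) is clause (F10),
`FontaineDatumExists.pinnedCrystallineExtensionDataExists`.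

## References

* [Calegari2010] F. Calegari, *Even Galois representations and the Fontaine–Mazur conjecture*,
  Invent. Math. 185 (2011), §2 (Lemma 2.1: `ψ = ⊗-Ind ρ` is crystalline with distinct weights
  when the gaps differ).
* [FontaineAsterisque223III] J.-M. Fontaine, *Représentations p-adiques semi-stables*, Astérisque
  223 (1994), Exp. III §1.5 (`D_dR`, `D_cris` are ⊗-functors; weights of a tensor product), §5.1.
* [BrinonConrad2009] O. Brinon, B. Conrad, *CMI Summer School notes on p-adic Hodge theory*
  (2009), §6.3 (`D_dR` on `Rep^{dR}` is an exact faithful ⊗-functor to `Fil_K`), §9.1,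
  Prop. 9.1.9, Prop. 9.1.11 (`Rep^{cris}` is ⊗-stable, `D_cris` a ⊗-functor), Prop. 6.3.8.
* [BarnetlambEtAl2014] T. Barnet-Lamb, T. Gee, D. Geraghty, R. Taylor, *Potential automorphy and
  change of weight*, Ann. of Math. 179 (2014), §1.4 (p. 14, remark (5); the open question on rank
  two).
* X. Caruso, *An introduction to p-adic period rings* (2019), arXiv:1908.08424, Def. 1.4.2 and
  §4.2–§4.3 ("`Rep^{cris}` is an abelian subcategory of `Rep^{dR}` stable by direct sums, duals,
  tensor products, subobjects and quotients") — corpus cross-check of the two schemata.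
-/

noncomputable section

-- project-wide option (lakefile weak.linter.dupNamespace); `Summit.Langlands.Langlands` is mandated
set_option linter.dupNamespace false

open scoped NumberField Kronecker
open IsDedekindDomain Field ValuativeRel
open Literature.NumberTheory.GaloisRepresentations Literature.NumberTheory.PAdicHodge
  Literature.NumberTheory.Automorphic

namespace Summit.Langlands.Langlands.Theorems.TensorSquareParallel

/-! ### The two Kronecker schemata for THE pinned Fontaine datum (named facts, D-0014) -/

/-- **Stub `stub_tensorInductionLocal` of line `merged`, RE-TYPED as (2a)
`stub_tensorLocalCrystalline_of_schemata` — the local clause (T3)(a)(b)(c) of Calegari's tensor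
induction, from named facts.**  Under `FontaineDatumExists`, `KroneckerCrystallineSchema`,
`KroneckerLabelledWeightsSchema`, `CrystallineBaseChange` and
`LabelledHodgeTateWeightsBaseChangeLabelwise`: for `F/ℚ` imaginary quadratic, `p` prime,
`ρ : Γ_F →ₜ* GL₂(ℚ̄_p)` pinned-de Rham with labelled weights `{a_τ < b_τ}` at every label above `p`
(`hHT`), `p ≥ 11` split in `F`, `ρ` pinned-crystalline above `p`, `ρ̄|_{Γ_{F(ζ_p)}}` absolutely
irreducible (`hG`), two labels `(v₀,τ)`, `(w₀,σ)` with weights `{a<b}`, `{a'<b'}` and `b−a ≠ b'−a'`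
(`hNP`), and every `ψ : Γ_ℚ →ₜ* GL₄(ℚ̄_p)` with
`ψ(res σ) = P · e_*(ρ(σ) ⊗ₖ ρ(θ_{τ₀} σ)) · P⁻¹` on `Γ_F` for some `τ₀ ∉ res(Γ_F)` ((T0')), at every
place `v` of `ℚ` above `p` and for THE pinned datum `fontainePstAdicCompletion v p hv`:
(a) `ψ|_{Γ_{ℚ_v}}` is crystalline; (b) every labelled Hodge–Tate multiset of `ψ` at `v` has no
repetition and cardinality `4` (it is `{a+a', a+b', b+a', b+b'}`); (c) compatible crystalline
extension data over the datum exist.  The registered clause (d) (potential diagonalisability) is the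
separate OPEN input (2b), see the module docstring.  Proof: module docstring, steps (0)–(5).
[cite: Calegari2010, §2 (Lemma 2.1)] [cite: BarnetlambEtAl2014, §1.4]
[cite: BrinonConrad2009, §9.1 and §6.3] -/
theorem stub_tensorLocalCrystalline_of_schemata :
    FontaineDatumExists → Literature.NumberTheory.PAdicHodge.KroneckerCrystallineSchema → Literature.NumberTheory.PAdicHodge.KroneckerLabelledWeightsSchema → CrystallineBaseChange → LabelledHodgeTateWeightsBaseChangeLabelwise → ∀ (F : Type) [Field F] [NumberField F] [Algebra.IsQuadraticExtension ℚ F], NumberField.IsTotallyComplex F → ∀ (p : ℕ) [Fact p.Prime] (ρ : FramedGaloisRep F (PadicAlgCl p) 2), (∀ (v : HeightOneSpectrum (𝓞 F)) (hv : ((p : ℕ) : 𝓞 F) ∈ v.asIdeal), (fontainePstAdicCompletion v p hv).IsDeRhamFramed (ρ.toLocal v) ∧ (letI := (fontainePstAdicCompletion v p hv).algebra; ∀ τ : v.adicCompletion F →ₐ[ℚ_[p]] PadicAlgCl p, ∃ a b : ℤ, a < b ∧ ρ.labelledHodgeTateWeightsAt v (fontainePstAdicCompletion v p hv).algebra (fontainePstAdicCompletion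 v p hv).𝔅 τ.toRingHom = {a, b})) → (11 ≤ p ∧ (∃ v w : HeightOneSpectrum (𝓞 F), v ≠ w ∧ ((p : ℕ) : 𝓞 F) ∈ v.asIdeal ∧ ((p : ℕ) : 𝓞 F) ∈ w.asIdeal) ∧ (∀ (v : HeightOneSpectrum (𝓞 F)) (hv : ((p : ℕ) : 𝓞 F) ∈ v.asIdeal), (fontainePstAdicCompletion v p hv).IsCrystallineFramed (ρ.toLocal v)) ∧ FramedGaloisRep.IsResiduallyAbsIrreducible (ρ.restrictField (CyclotomicField p F))) → (∃ (v : HeightOneSpectrum (𝓞 F)) (hv : ((p : ℕ) : 𝓞 F) ∈ v.asIdeal) (w : HeightOneSpectrum (𝓞 F)) (hw : ((p : ℕ) : 𝓞 F) ∈ w.asIdeal), letI := (fontainePstAdicCompletion v p hv).algebra; letI := (fontainePstAdicCompletion w p hw).algebra; ∃ (τ : v.adicCompletion F →ₐ[ℚ_[p]] PadicAlgCl p) (σ : w.adicCompletion F →ₐ[ℚ_[p]] PadicAlgCl p) (a b a' b' : ℤ), ρ.labelledHodgeTateWeightsAt v (fontainePstAdicCompletion v p hv).algebra (fontainePstAdicCompletion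 v p hv).𝔅 τ.toRingHom = {a, b} ∧ a < b ∧ ρ.labelledHodgeTateWeightsAt w (fontainePstAdicCompletion w p hw).algebra (fontainePstAdicCompletion w p hw).𝔅 σ.toRingHom = {a', b'} ∧ a' < b' ∧ b - a ≠ b' - a') → ∀ ψ : FramedGaloisRep ℚ (PadicAlgCl p) 4, (∃ (τ₀ : absoluteGaloisGroup ℚ) (_ : τ₀ ∉ Set.range (absGaloisRestrict ℚ F)) (e : Fin 2 × Fin 2 ≃ Fin 4) (P : GL (Fin 4) (PadicAlgCl p)), ∀ σ : absoluteGaloisGroup F, (ψ (absGaloisRestrict ℚ F σ)).val = P.val * Matrix.reindex e e ((ρ σ).val ⊗ₖ (ρ (absGaloisOuterConj ℚ F τ₀ σ)).val) * P⁻¹.val) → (∀ (v : HeightOneSpectrum (𝓞 ℚ)) (hv : ((p : ℕ) : 𝓞 ℚ) ∈ v.asIdeal), (fontainePstAdicCompletion v p hv).IsCrystallineFramed (ψ.toLocal v) ∧ (letI := (fontainePstAdicCompletion v p hv).algebra; (∀ τ : v.adicCompletion ℚ →ₐ[ℚ_[p]] PadicAlgCl p, (let M := ψ.labelledHodgeTateWeightsAt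 v (fontainePstAdicCompletion v p hv).algebra (fontainePstAdicCompletion v p hv).𝔅 τ.toRingHom; M.Nodup ∧ Multiset.card M = 4)) ∧ Nonempty (PstCrystallineExtensionData (fontainePstAdicCompletion v p hv)))) := by
  intro hFD hKC hKW hCB hLW F _ _ _ hF p _ ρ hHT hG hNP ψ hT0' v hv
  obtain ⟨-, hsplit, hcrys, -⟩ := hG
  obtain ⟨v₀, hv₀, w₀, hw₀, τN, σN, a, b, a', b', hτN, hab, hσN, hab', hgap⟩ := hNP
  obtain ⟨τ₀, hτ₀, e, P, hψ⟩ := hT0'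
  -- the pinned `ℚ_p`-structures at the three completions, and one label at `v₀`, `w₀`
  have halg₀ := fontainePstAdicCompletion_algebra_eq_adicCompletionPadicAlgebra v₀ p hv₀
  have halg₁ := fontainePstAdicCompletion_algebra_eq_adicCompletionPadicAlgebra w₀ p hw₀
  -- Step 0: the two places of `hNP` are distinct (equal places have ONE label, equal gaps)
  have hne : v₀ ≠ w₀ := by
    rintro rfl
    obtain ⟨u₁, u₂, hu, hu₁, hu₂⟩ := hsplit
    -- some place `u ≠ v₀` above `p`, so labels at `v₀` are unique
    obtain ⟨u, hpu, huv⟩ : ∃ u : HeightOneSpectrum (𝓞 F), ((p : ℕ) : 𝓞 F) ∈ u.asIdeal ∧ u ≠ v₀ := by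
      by_cases h : u₁ = v₀
      · exact ⟨u₂, hu₂, fun h' => hu (h.trans h'.symm)⟩
      · exact ⟨u₁, hu₁, h⟩
    haveI : Subsingleton (@AlgHom ℚ_[p] (v₀.adicCompletion F) (PadicAlgCl p) _ _ _
        (fontainePstAdicCompletion v₀ p hv₀).algebra _) := by
      rw [halg₀]
      exact LocalField.subsingleton_algHom_adicCompletion_of_split p v₀ u huv.symm hv₀ hpu _
    have hτσ : τN = σN := Subsingleton.elim _ _
    rw [hτσ, hσN] at hτN
    obtain ⟨rfl, rfl⟩ := pair_eq_pair_of_lt hab' hab hτN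
    exact hgap rfl
  obtain ⟨⟨he₀, hf₀⟩, -⟩ :=
    LocalField.ramificationIdx_eq_one_and_inertiaDeg_eq_one_of_ne p v₀ w₀ hne hv₀ hw₀
  obtain ⟨⟨he₁, hf₁⟩, -⟩ :=
    LocalField.ramificationIdx_eq_one_and_inertiaDeg_eq_one_of_ne p w₀ v₀ hne.symm hw₀ hv₀
  haveI hsub₀ : Subsingleton (@AlgHom ℚ_[p] (v₀.adicCompletion F) (PadicAlgCl p) _ _ _
      (fontainePstAdicCompletion v₀ p hv₀).algebra _) := by
    rw [halg₀]; exact LocalField.subsingleton_algHom_adicCompletion_of_degree_one p v₀ hv₀ he₀ hf₀ _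
  haveI hsub₁ : Subsingleton (@AlgHom ℚ_[p] (w₀.adicCompletion F) (PadicAlgCl p) _ _ _
      (fontainePstAdicCompletion w₀ p hw₀).algebra _) := by
    rw [halg₁]; exact LocalField.subsingleton_algHom_adicCompletion_of_degree_one p w₀ hw₀ he₁ hf₁ _
  -- `v₀` and `w₀` lie over the place `v` of `ℚ`
  have hunder₀ : v₀.under (𝓞 ℚ) = v :=
    LocalField.heightOneSpectrum_rat_eq_of_natCast_mem p _ _
      (LocalField.natCast_mem_under p v₀ hv₀) hv
  have hunder₁ : w₀.under (𝓞 ℚ) = v :=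
    LocalField.heightOneSpectrum_rat_eq_of_natCast_mem p _ _
      (LocalField.natCast_mem_under p w₀ hw₀) hv
  haveI hlo : v₀.asIdeal.LiesOver v.asIdeal := by rw [← hunder₀]; exact liesOver_under v₀
  -- Step 1: the image `g` of `τ₀` in `Gal(F/ℚ)` swaps the two places: `g⁻¹ • w₀ = v₀`
  set g : F ≃ₐ[ℚ] F := absGaloisQuot ℚ F τ₀ with hgdef
  have hg1 : g ≠ 1 := fun h1 => hτ₀ (by
    obtain ⟨σ, hσ⟩ := (absGaloisQuot_eq_one_iff ℚ F τ₀).1 h1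
    exact ⟨σ, hσ⟩)
  obtain ⟨s, hs⟩ := HeightOneSpectrum.exists_algEquiv_smul_eq ℚ (w := v₀) (w' := w₀)
    (hunder₀.trans hunder₁.symm)
  have hs1 : s ≠ 1 := by
    rintro rfl
    rw [one_smul] at hs
    exact hne hs
  have hcard : Nat.card (F ≃ₐ[ℚ] F) = 2 := by
    rw [IsGalois.card_aut_eq_finrank, Algebra.IsQuadraticExtension.finrank_eq_two ℚ F]
  have hsg : s = g := eq_of_ne_one_of_card_eq_two hcard hs1 hg1
  have hgv : g⁻¹ • w₀ = v₀ := by rw [← hsg, ← hs, inv_smul_smul]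
  -- Step 2: `ψ|_{Γ_F} = P · R · P⁻¹` with `R` the relabelled Kronecker product `ρ ⊗ ρ^{θ}`
  set θ := absGaloisOuterConj ℚ F τ₀ with hθdef
  set R : FramedGaloisRep F (PadicAlgCl p) 4 := FramedRep.conj P⁻¹ (ψ.restrictField F) with hRdef
  have hR : ∀ σ : absoluteGaloisGroup F,
      (R σ).val = Matrix.reindex e e ((ρ σ).val ⊗ₖ (ρ (θ σ)).val) := by
    intro σ
    rw [hRdef, FramedRep.conj_apply, inv_inv, Units.val_mul, Units.val_mul,
      FramedGaloisRep.restrictField_apply, hψ σ]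
    simp only [← Matrix.mul_assoc, Units.inv_mul, Matrix.one_mul]
    rw [Matrix.mul_assoc, Units.inv_mul, Matrix.mul_one]
  have hψR : ψ.restrictField F = FramedRep.conj P R := by
    rw [hRdef, ← FramedRep.conj_mul_eq_conj_conj, mul_inv_cancel, FramedRep.conj_one_eq]
  -- Step 3: localise at `v₀ ∣ v`: `(ψ|_{Γ_{ℚ_v}})|_{Γ_{F_{v₀}}}` is a conjugate of
  -- `R|_{Γ_{F_{v₀}}}`
  letI algα : Algebra (v.adicCompletion ℚ) (v₀.adicCompletion F) :=
    (adicCompletionOfLiesOver ℚ F v v₀).toAlgebra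
  obtain ⟨t₁, ht₁⟩ := exists_toLocal_restrictField_eq_conj ψ v v₀
  rw [hψR, FramedGaloisRep.toLocal_conj] at ht₁
  -- ht₁ : conj P (R.toLocal v₀) = conj (ψ t₁) ((ψ.toLocal v).comp res_α)
  have hX : (ψ.toLocal v).comp (absGaloisRestrict (v.adicCompletion ℚ) (v₀.adicCompletion F)) =
      FramedRep.conj ((ψ t₁)⁻¹ * P) (R.toLocal v₀) := by
    rw [FramedRep.conj_mul_eq_conj_conj, ht₁, FramedRep.conj_inv_conj_eq]
  -- Step 4: the second factor `(ρ ∘ θ)|_{Γ_{F_{v₀}}}` is `ρ|_{Γ_{F_{w₀}}}` transported along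
  -- `F_{w₀} ≅ F_{v₀}`
  letI algg : Algebra (w₀.adicCompletion F) (v₀.adicCompletion F) :=
    (galAdicCompletionMap (L := F) g⁻¹ hgv).toAlgebra
  have hgc : Continuous (algebraMap (w₀.adicCompletion F) (v₀.adicCompletion F)) :=
    continuous_galAdicCompletionMap F g⁻¹ hgv
  obtain ⟨δ, hδ⟩ := exists_toLocal_comp_absGaloisOuterConj_eq_conj (F₀ := ℚ) τ₀ ρ hgv
  -- Step 5: crystallinity over `F_{v₀}` (schema (S⊗1) + base change along `F_{w₀} → F_{v₀}`)
  haveI := LocalField.charZero_adicCompletion v₀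
  haveI := LocalField.charZero_adicCompletion w₀
  haveI := LocalField.charZero_adicCompletion v
  have hK₀ := LocalField.valuation_adicCompletion_natCast_lt_one v₀ p hv₀
  have hK₁ := LocalField.valuation_adicCompletion_natCast_lt_one w₀ p hw₀
  have hKv := LocalField.valuation_adicCompletion_natCast_lt_one v p hv
  have hc1 : (fontainePst (v₀.adicCompletion F) p hK₀).IsCrystallineFramed (ρ.toLocal v₀) :=
    hcrys v₀ hv₀
  have hc2 : (fontainePst (v₀.adicCompletion F) p hK₀).IsCrystallineFramed
      (FramedGaloisRep.toLocal v₀ (ρ.comp θ)) := by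
    rw [hθdef, hδ, PstWeilDeligneData.isCrystallineFramed_conj_iff]
    exact hCB p (w₀.adicCompletion F) (v₀.adicCompletion F) hgc hK₁ hK₀ 2 (ρ.toLocal w₀)
      (hcrys w₀ hw₀)
  have hcR : (fontainePst (v₀.adicCompletion F) p hK₀).IsCrystallineFramed (R.toLocal v₀) :=
    hKC p (v₀.adicCompletion F) hK₀ 2 2 4 e (ρ.toLocal v₀) (FramedGaloisRep.toLocal v₀ (ρ.comp θ))
      (R.toLocal v₀) (fun σ => hR _) hc1 hc2
  -- Step 6: transport to `ℚ_v` along the inverse of the degree-one iso `ℚ_v ≅ F_{v₀}`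
  have hbij := bijective_adicCompletionOfLiesOver_of_degree_one v v₀ he₀ hf₀
  set αe := RingEquiv.ofBijective (adicCompletionOfLiesOver ℚ F v v₀) hbij with hαe
  letI algβ : Algebra (v₀.adicCompletion F) (v.adicCompletion ℚ) := αe.symm.toRingHom.toAlgebra
  haveI : IsScalarTower (v.adicCompletion ℚ) (v₀.adicCompletion F) (v.adicCompletion ℚ) :=
    IsScalarTower.of_algebraMap_eq fun x => (αe.symm_apply_apply x).symm
  have hβc : Continuous (algebraMap (v₀.adicCompletion F) (v.adicCompletion ℚ)) :=
    continuous_symm_adicCompletionOfLiesOver_of_degree_one v v₀ he₀ hf₀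
  have hXc : (fontainePst (v₀.adicCompletion F) p hK₀).IsCrystallineFramed
      ((ψ.toLocal v).comp (absGaloisRestrict (v.adicCompletion ℚ) (v₀.adicCompletion F))) := by
    rw [hX, PstWeilDeligneData.isCrystallineFramed_conj_iff]
    exact hcR
  have hY := hCB p (v₀.adicCompletion F) (v.adicCompletion ℚ) hβc hK₀ hKv 4 _ hXc
  obtain ⟨t₂, ht₂⟩ := exists_comp_absGaloisRestrict_comp_absGaloisRestrict_eq_conj
    (K := v.adicCompletion ℚ) (L := v₀.adicCompletion F) (ψ.toLocal v)
  rw [ht₂, PstWeilDeligneData.isCrystallineFramed_conj_iff] at hY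
  refine ⟨hY, ?_, hFD.pinnedCrystallineExtensionDataExists ℚ p v hv⟩
  -- Step 7: the labelled weights at `v`
  letI i₀ : Algebra ℚ_[p] (v₀.adicCompletion F) := (fontainePst (v₀.adicCompletion F) p hK₀).algebra
  letI i₁ : Algebra ℚ_[p] (w₀.adicCompletion F) := (fontainePst (w₀.adicCompletion F) p hK₁).algebra
  letI iv : Algebra ℚ_[p] (v.adicCompletion ℚ) := (fontainePst (v.adicCompletion ℚ) p hKv).algebra
  intro τ
  -- the label `τ₁ = τ ∘ (F_{v₀} → ℚ_v)` of `F_{v₀}` and `σ₁ = τ₁ ∘ (F_{w₀} → F_{v₀})` of `F_{w₀}`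
  obtain ⟨τ₁, hτ₁⟩ := exists_algHom_toRingHom_eq_comp (K := v₀.adicCompletion F)
    (L := v.adicCompletion ℚ) hβc hK₀ hKv τ
  obtain ⟨σ₁, hσ₁⟩ := exists_algHom_toRingHom_eq_comp (K := w₀.adicCompletion F)
    (L := v₀.adicCompletion F) hgc hK₁ hK₀ τ₁
  have hτ₁N : τ₁ = τN := @Subsingleton.elim _ hsub₀ _ _
  have hσ₁N : σ₁ = σN := @Subsingleton.elim _ hsub₁ _ _
  -- factor 1
  have hw1 : (fontainePst (v₀.adicCompletion F) p hK₀).𝔅.labelledHodgeTateWeights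
      (FramedRep.toContinuousRep (ρ.toLocal v₀)) τ₁.toRingHom = {a, b} := by
    rw [hτ₁N]; exact hτN
  -- factor 2: frame change, then base change along `F_{w₀} → F_{v₀}` label by label
  have hw2 : (fontainePst (v₀.adicCompletion F) p hK₀).𝔅.labelledHodgeTateWeights
      (FramedRep.toContinuousRep (FramedGaloisRep.toLocal v₀ (ρ.comp θ))) τ₁.toRingHom =
        {a', b'} := by
    rw [hθdef, hδ]
    rw [PstWeilDeligneData.labelledHodgeTateWeights_conj_eq
      (fontainePst (v₀.adicCompletion F) p hK₀)]
    rw [hLW p (w₀.adicCompletion F) (v₀.adicCompletion F) hgc hK₁ hK₀ 2 (ρ.toLocal w₀) τ₁, ← hσ₁,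
      hσ₁N]
    exact hσN
  -- the Kronecker product at `τ₁` (schema (S⊗2))
  have hwR := hKW p (v₀.adicCompletion F) hK₀ 2 2 4 e (ρ.toLocal v₀)
    (FramedGaloisRep.toLocal v₀ (ρ.comp θ)) (R.toLocal v₀) (fun σ => hR _) (hHT v₀ hv₀).1
    hc2.isDeRhamFramed τ₁
  rw [hw1, hw2] at hwR
  -- `ψ|_{Γ_{ℚ_v}}` at `τ`: base change along `F_{v₀} → ℚ_v`, frame changes
  have e1 := hLW p (v₀.adicCompletion F) (v.adicCompletion ℚ) hβc hK₀ hKv 4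
    ((ψ.toLocal v).comp (absGaloisRestrict (v.adicCompletion ℚ) (v₀.adicCompletion F))) τ
  rw [ht₂, PstWeilDeligneData.labelledHodgeTateWeights_conj_eq, ← hτ₁, hX,
    PstWeilDeligneData.labelledHodgeTateWeights_conj_eq, hwR] at e1
  have hfinal : ψ.labelledHodgeTateWeightsAt v (fontainePstAdicCompletion v p hv).algebra
      (fontainePstAdicCompletion v p hv).𝔅 τ.toRingHom =
        ({a, b} : Multiset ℤ).bind fun x => ({a', b'} : Multiset ℤ).map fun y => x + y :=
    e1
  simpa only [hfinal] using nodup_and_card_pairSum hab hab' hgap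

end Summit.Langlands.Langlands.Theorems.TensorSquareParallel

end
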